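import Summits.Langlands.Langlands.Theses.AbelianSurfaceSerre
import HarnessLib

/-!
# Crux `AbelianSurfaceSerre.QuadraticImprimitiveSurfaces` (stmt-Langlands-17766), line `Sketch`:
# stub `stub_serreWreath_of_ordinarySerre` — full Serre for `GSp₄` ⟹ Serre at the wreath residues

Pure logic. The antecedent is VERBATIM the body of
`Summit.Langlands.Langlands.Theses.RegularSerreAbelianSurfaces.OrdinarySerreGSp4` (stmt-Langlands-17569:
Serre's conjecture for `GSp₄/ℚ` in regular ordinary weight through the `GL₄` proxy, `p ≥ P₀`); the
consequent is the same statement with the triangularisation hypothesis at `v ∣ p` strengthened to a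
residually `p`-distinguished one and three image hypotheses added (image of order
`2p²(p-1)(p²-1)² = |Δ_p ⋊ C₂|`, irreducible on `Γ_{ℚ(ζ_p)}`, reducible on `Γ_K` for some quadratic `K`),
i.e. the wreath residues `ρ̄_{A,p}` of BCGP 2025, proof of Lemma 10.4.1 (arXiv:2502.20645, p. 146).
More hypotheses, same conclusion: project the strengthened triangularisation to its first component
(`Exists.imp` / `And.left`) and discard the three image hypotheses.
-/

set_option linter.dupNamespace false

namespace Summit.Langlands.Langlands.Cruxes.QuadraticImprimitiveSurfaces.Sketch

/-- **Stub (pure logic): full Serre ⟹ Serre at the wreath residues.** The antecedent is the body of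
`RegularSerreAbelianSurfaces.OrdinarySerreGSp4`; the consequent is the same statement with the
triangularisation at `p` strengthened to a residually `p`-distinguished one and three image
hypotheses added (order `2p²(p-1)(p²-1)²`, irreducible on `Γ_{ℚ(ζ_p)}`, reducible on some quadratic
`Γ_K`) — the residues `ρ̄_{A,p}` of type-**B**[C₂] surfaces at large split good primes
(BCGP 2025, proof of Lemma 10.4.1, p. 146). More hypotheses, same conclusion. [folklore] -/
theorem stub_serreWreath_of_ordinarySerre :
    (∃ P₀ : ℕ, ∀ (p : ℕ) [Fact p.Prime], P₀ ≤ p → ∀ (k : Type) [Field k] [CharP k p] [IsAlgClosed k]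
    [TopologicalSpace k] [DiscreteTopology k] (red : Valued.integer (PadicAlgCl p) →+* k) (ρb :
    Literature.NumberTheory.GaloisRepresentations.FramedGaloisRep ℚ k 4),
    ρb.toGaloisRep.IsIrreducible → ρb.IsSymplecticWithMultiplierFun (fun g => (((Units.map
    (ZMod.castHom (dvd_refl p) k).toMonoidHom ((modularCyclotomicCharacter (AlgebraicClosure ℚ)
    (HasEnoughRootsOfUnity.natCard_rootsOfUnity (AlgebraicClosure ℚ) p)).comp
    (MulSemiringAction.toRingAut (Field.absoluteGaloisGroup ℚ) (AlgebraicClosure ℚ)) g))⁻¹ : kˣ) :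
    k)) → (∀ v : IsDedekindDomain.HeightOneSpectrum (NumberField.RingOfIntegers ℚ), ((p : ℕ) :
    NumberField.RingOfIntegers ℚ) ∈ v.asIdeal → ∃ g : Matrix.GeneralLinearGroup (Fin 4) k, ∀ (τ :
    Field.absoluteGaloisGroup (v.adicCompletion ℚ)) (i j : Fin 4), j < i → (g * ρb.toLocal v τ *
    g⁻¹).val i j = 0) → ∀ (hcpt :
    Literature.NumberTheory.Automorphic.isCompact_glFiniteIntegralLevel 4 ℚ) (ι : PadicAlgCl p ≃+*
    ℂ), ∃ (π : Literature.NumberTheory.Automorphic.CuspidalAutomorphicRepData 4 ℚ hcpt) (r :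
    Literature.NumberTheory.GaloisRepresentations.FramedGaloisRep ℚ (PadicAlgCl p) 4),
    π.1.IsRegularAlgebraic ∧ (∀ v : IsDedekindDomain.HeightOneSpectrum (NumberField.RingOfIntegers
    ℚ), ((p : ℕ) : NumberField.RingOfIntegers ℚ) ∈ v.asIdeal → π.1.IsUnramifiedAt v) ∧ (∃ μ :
    Field.absoluteGaloisGroup ℚ → PadicAlgCl p, r.IsSymplecticWithMultiplierFun μ) ∧ (∀ v :
    IsDedekindDomain.HeightOneSpectrum (NumberField.RingOfIntegers ℚ), ((p : ℕ) :
    NumberField.RingOfIntegers ℚ) ∈ v.asIdeal → ∃ a : Fin 4 → ℕ, Function.Injective a ∧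
    r.IsGreenbergOrdinaryOfShapeAt v a) ∧ (∀ᶠ v : IsDedekindDomain.HeightOneSpectrum
    (NumberField.RingOfIntegers ℚ) in Filter.cofinite, ∃ α : Multiset ℂ, π.1.HasSatakeParamAt v α ∧
    r.IsUnramifiedAt v ∧ r.HasFrobCharpolyAt v
    (Literature.NumberTheory.Automorphic.arithFrobPolyOfSatake ι v.residueCard 4 α)) ∧ (∀ᶠ v :
    IsDedekindDomain.HeightOneSpectrum (NumberField.RingOfIntegers ℚ) in Filter.cofinite,
    r.IsUnramifiedAt v ∧ ρb.IsUnramifiedAt v ∧ ∃ (P : Polynomial (Valued.integer (PadicAlgCl p)))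
    (Pb : Polynomial k), r.HasFrobCharpolyAt v (P.map (Valued.integer (PadicAlgCl p)).subtype) ∧
    ρb.HasFrobCharpolyAt v Pb ∧ P.map red = Pb)) →
    ∃ P₀ : ℕ, ∀ (p : ℕ) [Fact p.Prime], P₀ ≤ p → ∀ (k : Type) [Field k] [CharP k p] [IsAlgClosed k]
    [TopologicalSpace k] [DiscreteTopology k] (red : Valued.integer (PadicAlgCl p) →+* k) (ρb :
    Literature.NumberTheory.GaloisRepresentations.FramedGaloisRep ℚ k 4),
    ρb.toGaloisRep.IsIrreducible → ρb.IsSymplecticWithMultiplierFun (fun g => (((Units.map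
    (ZMod.castHom (dvd_refl p) k).toMonoidHom ((modularCyclotomicCharacter (AlgebraicClosure ℚ)
    (HasEnoughRootsOfUnity.natCard_rootsOfUnity (AlgebraicClosure ℚ) p)).comp
    (MulSemiringAction.toRingAut (Field.absoluteGaloisGroup ℚ) (AlgebraicClosure ℚ)) g))⁻¹ : kˣ) :
    k)) → (∀ v : IsDedekindDomain.HeightOneSpectrum (NumberField.RingOfIntegers ℚ), ((p : ℕ) :
    NumberField.RingOfIntegers ℚ) ∈ v.asIdeal → ∃ g : Matrix.GeneralLinearGroup (Fin 4) k, (∀ (τ :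
    Field.absoluteGaloisGroup (v.adicCompletion ℚ)) (i j : Fin 4), j < i → (g * ρb.toLocal v τ *
    g⁻¹).val i j = 0) ∧ ∀ i j : Fin 4, i ≠ j → ∃ τ : Field.absoluteGaloisGroup (v.adicCompletion ℚ),
    (g * ρb.toLocal v τ * g⁻¹).val i i ≠ (g * ρb.toLocal v τ * g⁻¹).val j j) → Nat.card
    ρb.toMonoidHom.range = 2 * p ^ 2 * (p - 1) * (p ^ 2 - 1) ^ 2 → (ρb.restrictField
    (CyclotomicField p ℚ)).toGaloisRep.IsIrreducible → (∃ (K : Type) (_ : Field K) (_ : NumberField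
    K), Module.finrank ℚ K = 2 ∧ ¬ (ρb.restrictField K).toGaloisRep.IsIrreducible) → ∀ (hcpt :
    Literature.NumberTheory.Automorphic.isCompact_glFiniteIntegralLevel 4 ℚ) (ι : PadicAlgCl p ≃+*
    ℂ), ∃ (π : Literature.NumberTheory.Automorphic.CuspidalAutomorphicRepData 4 ℚ hcpt) (r :
    Literature.NumberTheory.GaloisRepresentations.FramedGaloisRep ℚ (PadicAlgCl p) 4),
    π.1.IsRegularAlgebraic ∧ (∀ v : IsDedekindDomain.HeightOneSpectrum (NumberField.RingOfIntegers
    ℚ), ((p : ℕ) : NumberField.RingOfIntegers ℚ) ∈ v.asIdeal → π.1.IsUnramifiedAt v) ∧ (∃ μ :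
    Field.absoluteGaloisGroup ℚ → PadicAlgCl p, r.IsSymplecticWithMultiplierFun μ) ∧ (∀ v :
    IsDedekindDomain.HeightOneSpectrum (NumberField.RingOfIntegers ℚ), ((p : ℕ) :
    NumberField.RingOfIntegers ℚ) ∈ v.asIdeal → ∃ a : Fin 4 → ℕ, Function.Injective a ∧
    r.IsGreenbergOrdinaryOfShapeAt v a) ∧ (∀ᶠ v : IsDedekindDomain.HeightOneSpectrum
    (NumberField.RingOfIntegers ℚ) in Filter.cofinite, ∃ α : Multiset ℂ, π.1.HasSatakeParamAt v α ∧
    r.IsUnramifiedAt v ∧ r.HasFrobCharpolyAt v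
    (Literature.NumberTheory.Automorphic.arithFrobPolyOfSatake ι v.residueCard 4 α)) ∧ (∀ᶠ v :
    IsDedekindDomain.HeightOneSpectrum (NumberField.RingOfIntegers ℚ) in Filter.cofinite,
    r.IsUnramifiedAt v ∧ ρb.IsUnramifiedAt v ∧ ∃ (P : Polynomial (Valued.integer (PadicAlgCl p)))
    (Pb : Polynomial k), r.HasFrobCharpolyAt v (P.map (Valued.integer (PadicAlgCl p)).subtype) ∧
    ρb.HasFrobCharpolyAt v Pb ∧ P.map red = Pb) := by
  rintro ⟨P₀, h⟩
  refine ⟨P₀, ?_⟩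
  intro p _ hp k _ _ _ _ _ red ρb hirr hsymp htri _hcard _hcyc _hK hcpt ι
  exact h p hp k red ρb hirr hsymp (fun v hv => (htri v hv).imp fun g hg => hg.1) hcpt ι

end Summit.Langlands.Langlands.Cruxes.QuadraticImprimitiveSurfaces.Sketch
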